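/-
Copyright: the b2b-balaban T⁴-continuum CRUX team, row NE7b leaf lineage `t4-ne7b-formalise-leaf-04` (gen 150). Project licence.
-/
import Literature.Analysis.Convex.ProximalMap
import Mathlib.Analysis.Convex.Strong
import Mathlib.Analysis.Calculus.Gradient.Basic

/-!
# THE SOFT STEP MANUFACTURES ITS OWN LETTERS: the Moreau envelope `e_f(x) = min_z [f z + ½‖z − x‖²]` of ANY finite convex `f` is `C¹`
# with gradient `x − prox f x` (Moreau's theorem), the gradient is `1`-Lipschitz (firmly non-expansive), and the sockets' PAIR of
# first-order letters holds about EVERY point from `f`'s convexity data ALONE — growth constant `½` (the kernel's, `f`-independent) and,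
# for `m`-strongly convex `f`, modulus `m∕(1+m)` (RESISTANCES ADD) — no derivative, growth or window letter on `f` is asked
# (row NE7b, node U5c; residual (R2′) family (2), letters (ℓ1)∕(ℓ2) through a CLASSICAL (minimisation) step; [folklore] convex analysis)

Cell `pub-balaban`, sub-cell `t4`, spine estimate NE7b (`T4WeightBudget.RelWeightBound`; the cell's OWN estimate — NOT PRINTED in
[Bałaban 1983–89], NOT PROVED).  Crux-route work under `Spine/NE7b/` by leaf-04 on the convexity road; NOTHING of Bałaban's is named or
asserted; no `T4Continuum/Support` leaf typed; no `def`; zero `sorry`.  Imports: the tree's BUILT `Literature.Analysis.Convex.ProximalMap`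
(Moreau's `prox`, the resolvent inclusion `x − prox f x ∈ ∂f(prox f x)`, firm non-expansiveness — Hiriart-Urruty–Lemaréchal 2001 Chap. D∕E,
Moreau 1965) and Mathlib — independent of the `Spine/NE7b` olean frontier.

WHY.  The OWNER's step cluster (30)–(34) (`…FluctuationStepModulus ∕ …Marginal ∕ …Growth ∕ …Deriv ∕ …Letters`) types, for the FLUCTUATION
INTEGRAL `V⁺(ψ) = −log ∫ e^{−(V φ + G(ψ − Qφ))} dφ`, that the next action's two letters and its derivative come from the STEP's data alone
(modulus `aσ∕(σ + aκ²)`, growth = the weight's constant, `HasFDerivAt V⁺` everywhere).  For the road's CLASSICAL steps (background fields =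
minimisers) the typed value-function letters ASK something of the fine action beyond convexity (`…ConstrainedValueDeriv`: `V` differentiable
at the minimiser; `…ConstrainedValueGrowth`: `V`'s own upper letter; this lineage's `…AveragingFloorTower` ∕ `…BlockPoincareFibreFloor`:
FLOORS, not first-order letters; `…StrongConvexSubgradientField`: an «any vector field» fallback because an infimal value need not be `C¹`).
THIS FILE is the classical twin of (30)–(34) for the SOFT (quadratic-penalty) step `e_f(x) = min_z [f z + ½‖z − x‖²]` (Moreau envelope ∕
Moreau–Yosida regularisation), asking NOTHING of `f` but finiteness and convexity: `e_f` is `C¹` with the explicit gradient `x − prox f x`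
(Moreau 1965), the gradient is firmly non-expansive hence `1`-Lipschitz (`e_f ∈ C^{1,1}`), the UPPER letter holds with the kernel's constant
`½` for every convex `f` (the soft step REGULARISES — cf. (32)), the LOWER letter with modulus `0`, and with modulus `m∕(1+m)` for
`m`-strongly convex `f` — the resistance law `(λ⁺)⁻¹ = m⁻¹ + 1` of `…AveragingFloorTower` §2 ∕ (30) in FIRST-ORDER currency with an honest
gradient; and the minimiser `prox f x` contracts by `(1+m)⁻¹`.

WHAT IS PROVED ([folklore]: Moreau, Bull. SMF 93 (1965) 273–299; Hiriart-Urruty–Lemaréchal 2001 Chap. E Ex. 2.1.4 ∕ Chap. D Prop. 6.1.1;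
Bauschke–Combettes 2011 Prop. 12.29–12.30; Rockafellar–Wets Thm. 2.26 — proved here from the tree's `prox` API, nothing cited as a fact).
Throughout `E` is a finite-dimensional real inner product space, `f : E → ℝ` is `ConvexOn ℝ univ`, and the envelope is WRITTEN OUT as
`proxFun f x (prox f x) = f (prox f x) + ‖prox f x − x‖²∕2` (no new definition):
* §1 `proxEnv_le` (`e_f(x) ≤ f z + ½‖z − x‖²` for every `z`; `z = x` gives `e_f ≤ f`).
* §2 THE SANDWICH: `proxEnv_upper` (`e_f(x′) ≤ e_f(x) + ⟪x − prox f x, x′ − x⟫ + ½‖x′ − x‖²` — the competitor `prox f x` in the problem at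
  `x′`), **`proxEnv_lower_sharp`** (`e_f(x) + ⟪x − prox f x, x′ − x⟫ + ½‖(x − prox f x) − (x′ − prox f x′)‖² ≤ e_f(x′)` — the resolvent
  inclusion at `prox f x` tested at `prox f x′`), `proxEnv_lower`, `proxEnv_remainder_nonneg` ∕ `proxEnv_remainder_le`
  (`0 ≤ e_f(x′) − e_f(x) − ⟪x − prox f x, x′ − x⟫ ≤ ½‖x′ − x‖²`).
* §3 **MOREAU's THEOREM** `hasGradientAt_proxEnv` (`HasGradientAt e_f (x − prox f x) x` at EVERY `x`), `hasFDerivAt_proxEnv`,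
  `differentiable_proxEnv`, `gradient_proxEnv` (`∇e_f x = x − prox f x`).
* §4 THE GRADIENT IS FIRMLY NON-EXPANSIVE: `norm_gradEnv_sub_sq_le_inner` (`‖∇e_f x − ∇e_f x′‖² ≤ ⟪x − x′, ∇e_f x − ∇e_f x′⟫`),
  `inner_gradEnv_sub_nonneg` (monotone), **`norm_gradEnv_sub_le`** (`‖∇e_f x − ∇e_f x′‖ ≤ ‖x − x′‖`), `lipschitzWith_gradEnv`.
* §5 THE SOCKETS' PAIR FROM `f`'s DATA ALONE: `proxEnv_growth` (UPPER letter, constant `½`, every convex `f`; the LOWER letter with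
  modulus `0` is §2's `proxEnv_lower`), the strong subgradient inequality at the proximal point `strongSubgradient_prox` (`f (prox f x) + ⟪x − prox f x, z − prox f x⟫
  + (m∕2)‖z − prox f x‖² ≤ f z` for `StrongConvexOn univ m f`, `0 ≤ m`, via the tree's resolvent lemma applied to the RESCALED problem
  `(f − (m∕2)‖·‖²)∕(1+m)` at `x∕(1+m)`), the parallel-sum inequality `parallelSum_norm_sq_le`, and **`proxEnv_firstOrder_of_strongConvexOn`**
  (`e_f(x) + ⟪x − prox f x, x′ − x⟫ + ((m∕(1+m))∕2)‖x′ − x‖² ≤ e_f(x′)` — modulus `m∕(1+m)`, SHARP: `f = ½‖·‖²` gives `e_f = ¼‖·‖²`),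
  `proxEnv_twoSided_of_strongConvexOn` (both at once), `strongConvexOn_proxEnv` (secant currency, Mathlib's `StrongConvexOn univ (m∕(1+m))`).
* §5b THE MINIMISER CONTRACTS (strongly convex `f`, `0 ≤ m`): `inner_prox_sub_ge_of_strongConvexOn` (`(1+m)‖prox f x − prox f x′‖² ≤
  ⟪x − x′, prox f x − prox f x′⟫`), **`norm_prox_sub_le_of_strongConvexOn`** (`‖prox f x − prox f x′‖ ≤ (1+m)⁻¹‖x − x′‖` — the soft step's
  background field is a `(1+m)⁻¹`-contraction of the kept variable; sharp).
* §6 toys: `prox_zero` ∕ `proxEnv_zero` (`prox 0 = id`, `e_0 = 0`), `prox_half_norm_sq` (`prox (½‖·‖²) x = ½x`: modulus `m∕(1+m) = ½` attained).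

NOT HERE (honest): the weight-`a` ∕ operator-`P` bookkeeping `min_y [S y + a‖x − P y‖²] = 2a·e_{φ∕(2a)}(x)` with `φ` the hard-constraint
value `u ↦ min {S y : P y = u}` (leaf-03's `…ConstrainedValue*` object; then gradient `2a(x − prox)`, Lipschitz `2a`, growth `a`, modulus
`2am∕(2a + m)`) — a rescaling of §3–§5, typed when a consumer names the shape; convex `f` with value `+∞` off a window (the tree's `prox` is for
finite `f` on `univ`; the envelope of a windowed `f` is still `C¹` — not typed); `C¹` dependence of the MINIMISER `prox f x` on `x` (beyond §5b's Lipschitz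
contraction; needs `f ∈ C²` and the implicit function theorem — the tree's `Literature.Analysis.Calculus.FixedPointSmoothDependence` is the tool); which of print's steps are soft classical steps in which chart
((A3) ∕ (A1c) — NC-NE7b-α UNRULED); anything of Bałaban's.  BY-NAME EFFECT ON THE WALL: NONE.  NE7b NOT PRINTED ∕ NOT PROVED; spine PROVED
0∕9; rung (B)+1 on a FINITE torus — NOT infinite volume, NOT the mass gap, NOT Clay.  HONEST DEPENDENCY: continuum YM on T⁴ ⇐ BetaPertH ∧ nine
spine estimates (0/9 proved); BetaPertH ⇐ (D1) ∧ (D4) ∧ CAP+tail; G-an2-4 gates asym, D1 and NE2∕3∕4.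
-/

set_option autoImplicit false

noncomputable section

namespace Summit.QuantumFields.BalabanUV.T4Continuum.NE7b.MoreauEnvelopeLetters

open Set Filter Topology InnerProductSpace
open scoped RealInnerProductSpace Gradient
open Literature.Analysis.Convex

variable {E : Type*} [NormedAddCommGroup E] [InnerProductSpace ℝ E] [FiniteDimensional ℝ E]
variable {f : E → ℝ}

/-! ## §1 The envelope value `e_f(x) = f (prox f x) + ½‖prox f x − x‖²` is the minimum -/

/-- **THE ENVELOPE IS THE MINIMUM**: `f (prox f x) + ½‖prox f x − x‖² ≤ f z + ½‖z − x‖²` for every `z` (the tree's `isMinOn_prox`).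
[folklore] -/
theorem proxEnv_le (hf : ConvexOn ℝ univ f) (x z : E) : proxFun f x (prox f x) ≤ proxFun f x z :=
  isMinOn_prox hf x (mem_univ z)

/-! ## §2 The two-sided sandwich about every point -/

/-- **UPPER HALF OF THE SANDWICH**: `e_f(x′) ≤ e_f(x) + ⟪x − prox f x, x′ − x⟫ + ½‖x′ − x‖²` — test the problem at `x′` with the
competitor `prox f x` and expand `‖prox f x − x′‖² = ‖prox f x − x‖² − 2⟪prox f x − x, x′ − x⟫ + ‖x′ − x‖²`. [folklore] -/
theorem proxEnv_upper (hf : ConvexOn ℝ univ f) (x x' : E) :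
    proxFun f x' (prox f x') ≤ proxFun f x (prox f x) + ⟪x - prox f x, x' - x⟫ + ‖x' - x‖ ^ 2 / 2 := by
  have h := proxEnv_le hf x' (prox f x)
  have e1 : ‖prox f x - x'‖ ^ 2 = ‖prox f x - x‖ ^ 2 - 2 * ⟪prox f x - x, x' - x⟫ + ‖x' - x‖ ^ 2 := by
    have : prox f x - x' = (prox f x - x) - (x' - x) := by abel
    rw [this, norm_sub_sq_real]
  have e2 : ⟪x - prox f x, x' - x⟫ = -⟪prox f x - x, x' - x⟫ := by rw [← neg_sub (prox f x) x, inner_neg_left]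
  simp only [proxFun_apply] at h ⊢
  rw [e1] at h
  rw [e2]
  linarith

/-- **LOWER HALF OF THE SANDWICH, WITH THE EXACT REMAINDER**: `e_f(x) + ⟪x − prox f x, x′ − x⟫ + ½‖(x − prox f x) − (x′ − prox f x′)‖² ≤ e_f(x′)`
— the resolvent inclusion `x − prox f x ∈ ∂f(prox f x)` tested at `prox f x′`, plus the algebraic identity
`⟪u, p′ − p⟫ + ½‖u′‖² − ½‖u‖² = ⟪u, x′ − x⟫ + ½‖u − u′‖²` for `u = x − p`, `u′ = x′ − p′`. [folklore] -/
theorem proxEnv_lower_sharp (hf : ConvexOn ℝ univ f) (x x' : E) :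
    proxFun f x (prox f x) + ⟪x - prox f x, x' - x⟫ + ‖(x - prox f x) - (x' - prox f x')‖ ^ 2 / 2 ≤ proxFun f x' (prox f x') := by
  set p := prox f x with hp
  set p' := prox f x' with hp'
  have hsub : f p + ⟪x - p, p' - p⟫ ≤ f p' := hasSubgradientWithinAt_prox hf x p' (mem_univ _)
  -- write everything in the letters `u = x − p`, `u' = x' − p'`, `d = x' − x`; then `p' − p = d − (u' − u)`
  have epp : p' - p = (x' - x) - ((x' - p') - (x - p)) := by abel
  have e1 : ⟪x - p, p' - p⟫ = ⟪x - p, x' - x⟫ - ⟪x - p, x' - p'⟫ + ‖x - p‖ ^ 2 := by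
    rw [epp, inner_sub_right (x - p) (x' - x) ((x' - p') - (x - p)), inner_sub_right (x - p) (x' - p') (x - p),
      real_inner_self_eq_norm_sq]
    ring
  have e2 : ‖(x - p) - (x' - p')‖ ^ 2 = ‖x - p‖ ^ 2 - 2 * ⟪x - p, x' - p'⟫ + ‖x' - p'‖ ^ 2 := norm_sub_sq_real _ _
  have e3 : ‖p - x‖ = ‖x - p‖ := norm_sub_rev _ _
  have e4 : ‖p' - x'‖ = ‖x' - p'‖ := norm_sub_rev _ _
  simp only [proxFun_apply]
  rw [e3, e4, e2]
  linarith

/-- **LOWER HALF OF THE SANDWICH**: `e_f(x) + ⟪x − prox f x, x′ − x⟫ ≤ e_f(x′)` (drop the non-negative remainder). [folklore] -/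
theorem proxEnv_lower (hf : ConvexOn ℝ univ f) (x x' : E) :
    proxFun f x (prox f x) + ⟪x - prox f x, x' - x⟫ ≤ proxFun f x' (prox f x') :=
  le_trans (by nlinarith [norm_nonneg ((x - prox f x) - (x' - prox f x'))]) (proxEnv_lower_sharp hf x x')

/-- The first-order remainder is NON-NEGATIVE: `0 ≤ e_f(x′) − e_f(x) − ⟪x − prox f x, x′ − x⟫`. [folklore] -/
theorem proxEnv_remainder_nonneg (hf : ConvexOn ℝ univ f) (x x' : E) :
    0 ≤ proxFun f x' (prox f x') - proxFun f x (prox f x) - ⟪x - prox f x, x' - x⟫ := by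
  linarith [proxEnv_lower hf x x']

/-- The first-order remainder is AT MOST THE KERNEL: `e_f(x′) − e_f(x) − ⟪x − prox f x, x′ − x⟫ ≤ ½‖x′ − x‖²`. [folklore] -/
theorem proxEnv_remainder_le (hf : ConvexOn ℝ univ f) (x x' : E) :
    proxFun f x' (prox f x') - proxFun f x (prox f x) - ⟪x - prox f x, x' - x⟫ ≤ ‖x' - x‖ ^ 2 / 2 := by
  linarith [proxEnv_upper hf x x']

/-! ## §3 Moreau's theorem: the envelope is differentiable everywhere with gradient `x − prox f x` -/

/-- **MOREAU's THEOREM.**  For a finite convex `f` on a finite-dimensional real inner product space, the Moreau envelope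
`x ↦ f (prox f x) + ½‖prox f x − x‖²` has GRADIENT `x − prox f x` at every `x` (from the sandwich
`0 ≤ e_f(x + h) − e_f(x) − ⟪x − prox f x, h⟫ ≤ ½‖h‖²`).  No differentiability of `f` is assumed. [folklore] (Moreau 1965) -/
theorem hasGradientAt_proxEnv (hf : ConvexOn ℝ univ f) (x : E) :
    HasGradientAt (fun y => proxFun f y (prox f y)) (x - prox f x) x := by
  rw [hasGradientAt_iff_hasFDerivAt, hasFDerivAt_iff_isLittleO_nhds_zero]
  refine Asymptotics.isLittleO_iff.2 fun c hc => ?_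
  have hball : ∀ᶠ h : E in 𝓝 0, ‖h‖ < 2 * c :=
    Metric.eventually_nhds_iff.2 ⟨2 * c, by positivity, fun h hh => by simpa [dist_zero_right] using hh⟩
  filter_upwards [hball] with h hh
  have h0 := proxEnv_remainder_nonneg hf x (x + h)
  have h2 := proxEnv_remainder_le hf x (x + h)
  simp only [add_sub_cancel_left] at h0 h2
  rw [toDual_apply_apply, Real.norm_of_nonneg h0]
  nlinarith [norm_nonneg h]

/-- Moreau's theorem in `HasFDerivAt` currency: the Fréchet derivative is `⟪x − prox f x, ·⟫`. [folklore] -/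
theorem hasFDerivAt_proxEnv (hf : ConvexOn ℝ univ f) (x : E) :
    HasFDerivAt (fun y => proxFun f y (prox f y)) (toDual ℝ E (x - prox f x)) x :=
  (hasGradientAt_proxEnv hf x).hasFDerivAt

/-- The envelope is differentiable. [folklore] -/
theorem differentiable_proxEnv (hf : ConvexOn ℝ univ f) : Differentiable ℝ (fun y => proxFun f y (prox f y)) :=
  fun x => (hasFDerivAt_proxEnv hf x).differentiableAt

/-- `∇e_f x = x − prox f x`. [folklore] -/
theorem gradient_proxEnv (hf : ConvexOn ℝ univ f) (x : E) : ∇ (fun y => proxFun f y (prox f y)) x = x - prox f x :=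
  (hasGradientAt_proxEnv hf x).gradient

/-! ## §4 The gradient `x − prox f x` is firmly non-expansive, hence `1`-Lipschitz -/

/-- **FIRM NON-EXPANSIVENESS OF THE GRADIENT**: `‖(x − prox f x) − (x′ − prox f x′)‖² ≤ ⟪x − x′, (x − prox f x) − (x′ − prox f x′)⟫`
(from the tree's firm non-expansiveness of `prox`: `‖q‖² ≤ ⟪d, q⟫` for `d = x − x′`, `q = prox f x − prox f x′`, and
`‖d − q‖² = ‖d‖² − 2⟪d, q⟫ + ‖q‖²`). [folklore] -/
theorem norm_gradEnv_sub_sq_le_inner (hf : ConvexOn ℝ univ f) (x x' : E) :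
    ‖(x - prox f x) - (x' - prox f x')‖ ^ 2 ≤ ⟪x - x', (x - prox f x) - (x' - prox f x')⟫ := by
  have h := norm_prox_sub_prox_sq_le hf x x'
  have e : (x - prox f x) - (x' - prox f x') = (x - x') - (prox f x - prox f x') := by abel
  rw [e, norm_sub_sq_real, inner_sub_right (x - x') (x - x') (prox f x - prox f x'), real_inner_self_eq_norm_sq]
  linarith

/-- **THE GRADIENT IS MONOTONE**: `0 ≤ ⟪x − x′, ∇e_f x − ∇e_f x′⟫` (the envelope is convex). [folklore] -/
theorem inner_gradEnv_sub_nonneg (hf : ConvexOn ℝ univ f) (x x' : E) :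
    0 ≤ ⟪x - x', (x - prox f x) - (x' - prox f x')⟫ :=
  le_trans (sq_nonneg _) (norm_gradEnv_sub_sq_le_inner hf x x')

/-- **THE GRADIENT IS `1`-LIPSCHITZ**: `‖(x − prox f x) − (x′ − prox f x′)‖ ≤ ‖x − x′‖` — the envelope is `C^{1,1}` with constant `1`
whatever the convex `f`. [folklore] -/
theorem norm_gradEnv_sub_le (hf : ConvexOn ℝ univ f) (x x' : E) :
    ‖(x - prox f x) - (x' - prox f x')‖ ≤ ‖x - x'‖ := by
  have h := norm_gradEnv_sub_sq_le_inner hf x x'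
  have hcs : ⟪x - x', (x - prox f x) - (x' - prox f x')⟫ ≤ ‖x - x'‖ * ‖(x - prox f x) - (x' - prox f x')‖ :=
    real_inner_le_norm _ _
  nlinarith [norm_nonneg (x - x'), norm_nonneg ((x - prox f x) - (x' - prox f x'))]

/-- The gradient map `x ↦ x − prox f x` is `LipschitzWith 1`. [folklore] -/
theorem lipschitzWith_gradEnv (hf : ConvexOn ℝ univ f) : LipschitzWith 1 (fun x => x - prox f x) :=
  LipschitzWith.of_dist_le_mul fun x x' => by
    simpa [dist_eq_norm] using norm_gradEnv_sub_le hf x x'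

/-! ## §5 The sockets' pair of letters from `f`'s convexity data alone -/

/-- **THE UPPER (GROWTH) LETTER, CONSTANT `½`, FOR EVERY CONVEX `f`**: `e_f(x′) ≤ e_f(x) + ⟪∇e_f x, x′ − x⟫ + ½‖x′ − x‖²` — the soft step
REGULARISES: the growth constant is the kernel's and nothing is asked of `f` (the classical twin of the OWNER's (32) «growth = the weight's
constant»). [folklore] -/
theorem proxEnv_growth (hf : ConvexOn ℝ univ f) (x x' : E) :
    proxFun f x' (prox f x') ≤ proxFun f x (prox f x) + ⟪x - prox f x, x' - x⟫ + (1 / 2) * ‖x' - x‖ ^ 2 := by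
  have := proxEnv_upper hf x x'; linarith

/-- **THE STRONG SUBGRADIENT INEQUALITY AT THE PROXIMAL POINT**: for `m`-strongly convex `f` (`0 ≤ m`),
`f (prox f x) + ⟪x − prox f x, z − prox f x⟫ + (m∕2)‖z − prox f x‖² ≤ f z` for every `z`.  Proof: `prox f x` also minimises the proximal
functional of the CONVEX function `g = (f − (m∕2)‖·‖²)∕(1+m)` based at `x∕(1+m)` (the two functionals differ by the factor `1+m` and a
constant), so the tree's resolvent lemma gives `x∕(1+m) − prox f x ∈ ∂g(prox f x)`; multiply by `1+m` and complete the square. [folklore] -/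
theorem strongSubgradient_prox {m : ℝ} (hf : StrongConvexOn univ m f) (hm : 0 ≤ m) (x z : E) :
    f (prox f x) + ⟪x - prox f x, z - prox f x⟫ + m / 2 * ‖z - prox f x‖ ^ 2 ≤ f z := by
  have hfc : ConvexOn ℝ univ f := hf.convexOn (fun r => by positivity)
  have h1m : 0 < 1 + m := by linarith
  set p := prox f x with hp
  -- the rescaled convex function and base point
  set g : E → ℝ := fun z => (f z - m / 2 * ‖z‖ ^ 2) / (1 + m) with hg
  have hgc : ConvexOn ℝ univ g := by
    have hc : ConvexOn ℝ univ (fun z => f z - m / 2 * ‖z‖ ^ 2) := strongConvexOn_iff_convex.mp hf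
    simpa [hg, div_eq_inv_mul] using hc.smul (inv_nonneg.mpr h1m.le)
  set x₁ : E := (1 + m)⁻¹ • x with hx₁
  -- the two proximal functionals agree up to the factor `1 + m` and a constant
  have key : ∀ z : E, (1 + m) * proxFun g x₁ z = proxFun f x z - m / (2 * (1 + m)) * ‖x‖ ^ 2 := by
    intro z
    simp only [proxFun_apply, hg, hx₁]
    rw [norm_sub_sq_real z ((1 + m)⁻¹ • x), norm_sub_sq_real z x, real_inner_smul_right, norm_smul, Real.norm_eq_abs,
      abs_of_pos (inv_pos.mpr h1m), mul_pow]
    field_simp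
    ring
  have hmin : IsMinOn (proxFun g x₁) univ p := by
    intro z _
    have h : proxFun f x p ≤ proxFun f x z := isMinOn_prox hfc x (mem_univ z)
    have h' : (1 + m) * proxFun g x₁ p ≤ (1 + m) * proxFun g x₁ z := by rw [key, key]; linarith
    exact le_of_mul_le_mul_left h' h1m
  have hsub := IsMinOn.hasSubgradientWithinAt_of_proxFun hgc hmin z (mem_univ z)
  -- `hsub : g p + ⟪x₁ − p, z − p⟫ ≤ g z`; multiply by `1 + m`
  have h2 : (1 + m) * g p + (1 + m) * ⟪x₁ - p, z - p⟫ ≤ (1 + m) * g z := by nlinarith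
  have eg : ∀ w : E, (1 + m) * g w = f w - m / 2 * ‖w‖ ^ 2 := fun w => by
    simp only [hg]; field_simp
  have ei : (1 + m) * ⟪x₁ - p, z - p⟫ = ⟪x - p, z - p⟫ - m * ⟪p, z - p⟫ := by
    rw [hx₁, inner_sub_left, inner_sub_left, real_inner_smul_left, mul_sub, ← mul_assoc, mul_inv_cancel₀ h1m.ne', one_mul]
    ring
  rw [eg, eg, ei] at h2
  have e3 : ‖z - p‖ ^ 2 = ‖z‖ ^ 2 - 2 * ⟪p, z - p⟫ - ‖p‖ ^ 2 := by
    rw [norm_sub_sq_real, inner_sub_right, real_inner_self_eq_norm_sq, real_inner_comm]; ring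
  rw [e3]
  linarith

omit [FiniteDimensional ℝ E] in
/-- **THE PARALLEL-SUM INEQUALITY** (resistances add, cf. `…AveragingFloorTower` §1): `(m∕(1+m))‖d‖² ≤ ‖q − d‖² + m‖q‖²` for `0 ≤ m`
(`(1+m)(‖q − d‖² + m‖q‖²) − m‖d‖² = ‖(q − d) + m q‖²`). [folklore] -/
theorem parallelSum_norm_sq_le {m : ℝ} (hm : 0 ≤ m) (q d : E) :
    m / (1 + m) * ‖d‖ ^ 2 ≤ ‖q - d‖ ^ 2 + m * ‖q‖ ^ 2 := by
  have h1m : 0 < 1 + m := by linarith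
  have hsq : 0 ≤ ‖(q - d) + m • q‖ ^ 2 := sq_nonneg _
  have e1 : ‖(q - d) + m • q‖ ^ 2 = ‖q - d‖ ^ 2 + 2 * m * ⟪q - d, q⟫ + m ^ 2 * ‖q‖ ^ 2 := by
    rw [norm_add_sq_real, real_inner_smul_right, norm_smul, Real.norm_eq_abs, abs_of_nonneg hm, mul_pow]; ring
  have e2 : ‖d‖ ^ 2 = ‖q‖ ^ 2 - 2 * ⟪q - d, q⟫ + ‖q - d‖ ^ 2 := by
    have : d = q - (q - d) := by abel
    rw [this, norm_sub_sq_real q (q - d), real_inner_comm]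
    abel_nf
  rw [div_mul_eq_mul_div, div_le_iff₀ h1m]
  nlinarith

/-- **THE LOWER LETTER WITH MODULUS `m∕(1+m)` FOR `m`-STRONGLY CONVEX `f`** (`0 ≤ m`):
`e_f(x) + ⟪∇e_f x, x′ − x⟫ + ((m∕(1+m))∕2)‖x′ − x‖² ≤ e_f(x′)` — RESISTANCES ADD, `(λ⁺)⁻¹ = m⁻¹ + 1`, in first-order currency with the
honest gradient of §3; SHARP (`f = ½‖·‖²`: `m = 1`, `e_f = ¼‖·‖²`, modulus `½`). [folklore] -/
theorem proxEnv_firstOrder_of_strongConvexOn {m : ℝ} (hf : StrongConvexOn univ m f) (hm : 0 ≤ m) (x x' : E) :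
    proxFun f x (prox f x) + ⟪x - prox f x, x' - x⟫ + (m / (1 + m)) / 2 * ‖x' - x‖ ^ 2 ≤ proxFun f x' (prox f x') := by
  set p := prox f x with hp
  set p' := prox f x' with hp'
  have hsub := strongSubgradient_prox hf hm x p'
  rw [← hp] at hsub
  -- letters `u = x − p`, `u' = x' − p'`, `d = x' − x`, `q = p' − p = d − (u' − u)`
  have hpar := parallelSum_norm_sq_le hm (p' - p) (x' - x)
  have epp : p' - p = (x' - x) - ((x' - p') - (x - p)) := by abel
  have e1 : ⟪x - p, p' - p⟫ = ⟪x - p, x' - x⟫ - ⟪x - p, x' - p'⟫ + ‖x - p‖ ^ 2 := by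
    rw [epp, inner_sub_right (x - p) (x' - x) ((x' - p') - (x - p)), inner_sub_right (x - p) (x' - p') (x - p),
      real_inner_self_eq_norm_sq]
    ring
  have e2 : ‖(p' - p) - (x' - x)‖ ^ 2 = ‖x - p‖ ^ 2 - 2 * ⟪x - p, x' - p'⟫ + ‖x' - p'‖ ^ 2 := by
    have : (p' - p) - (x' - x) = (x - p) - (x' - p') := by abel
    rw [this, norm_sub_sq_real]
  have e3 : ‖p - x‖ = ‖x - p‖ := norm_sub_rev _ _
  have e4 : ‖p' - x'‖ = ‖x' - p'‖ := norm_sub_rev _ _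
  simp only [proxFun_apply]
  rw [e3, e4]
  rw [e2] at hpar
  nlinarith [hsub, hpar, e1]

/-- **BOTH LETTERS AT ONCE** (the sockets' two-sided shape for the next action after a soft classical step):
`e_f(x) + ⟪∇e_f x, x′ − x⟫ + ((m∕(1+m))∕2)‖x′ − x‖² ≤ e_f(x′) ≤ e_f(x) + ⟪∇e_f x, x′ − x⟫ + ½‖x′ − x‖²`. [folklore] -/
theorem proxEnv_twoSided_of_strongConvexOn {m : ℝ} (hf : StrongConvexOn univ m f) (hm : 0 ≤ m) (x x' : E) :
    proxFun f x (prox f x) + ⟪x - prox f x, x' - x⟫ + (m / (1 + m)) / 2 * ‖x' - x‖ ^ 2 ≤ proxFun f x' (prox f x') ∧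
      proxFun f x' (prox f x') ≤ proxFun f x (prox f x) + ⟪x - prox f x, x' - x⟫ + (1 / 2) * ‖x' - x‖ ^ 2 :=
  ⟨proxEnv_firstOrder_of_strongConvexOn hf hm x x', proxEnv_growth (hf.convexOn (fun r => by positivity)) x x'⟩

/-- **SECANT CURRENCY**: the envelope of an `m`-strongly convex `f` (`0 ≤ m`) is `(m∕(1+m))`-strongly convex on `univ` (Mathlib's
`StrongConvexOn`), from the first-order letter at the intermediate point tested at both ends. [folklore] -/
theorem strongConvexOn_proxEnv {m : ℝ} (hf : StrongConvexOn univ m f) (hm : 0 ≤ m) :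
    StrongConvexOn univ (m / (1 + m)) (fun y => proxFun f y (prox f y)) := by
  refine ⟨convex_univ, fun x _ y _ a b ha hb hab => ?_⟩
  set z := a • x + b • y with hz
  have hx := proxEnv_firstOrder_of_strongConvexOn hf hm z x
  have hy := proxEnv_firstOrder_of_strongConvexOn hf hm z y
  -- `x − z = b • (x − y)`, `y − z = −a • (x − y)`
  have exz : x - z = b • (x - y) := by
    rw [hz]
    calc x - (a • x + b • y) = (1 - a) • x - b • y := by rw [sub_smul, one_smul]; abel
      _ = b • x - b • y := by rw [← hab]; ring_nf
      _ = b • (x - y) := by rw [smul_sub]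
  have eyz : y - z = -(a • (x - y)) := by
    rw [hz]
    calc y - (a • x + b • y) = (1 - b) • y - a • x := by rw [sub_smul, one_smul]; abel
      _ = a • y - a • x := by rw [← hab]; ring_nf
      _ = -(a • (x - y)) := by rw [smul_sub]; abel
  have hlin : a * ⟪z - prox f z, x - z⟫ + b * ⟪z - prox f z, y - z⟫ = 0 := by
    rw [exz, eyz, inner_neg_right, real_inner_smul_right, real_inner_smul_right]; ring
  have hnx : ‖x - z‖ ^ 2 = b ^ 2 * ‖x - y‖ ^ 2 := by rw [exz, norm_smul, Real.norm_eq_abs, abs_of_nonneg hb, mul_pow]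
  have hny : ‖y - z‖ ^ 2 = a ^ 2 * ‖x - y‖ ^ 2 := by
    rw [eyz, norm_neg, norm_smul, Real.norm_eq_abs, abs_of_nonneg ha, mul_pow]
  rw [hnx] at hx
  rw [hny] at hy
  simp only [smul_eq_mul]
  have hab' : b = 1 - a := by linarith
  -- `a·hx + b·hy`
  have := add_le_add (mul_le_mul_of_nonneg_left hx ha) (mul_le_mul_of_nonneg_left hy hb)
  rw [hab'] at this hlin ⊢
  nlinarith [this, hlin, sq_nonneg a, norm_nonneg (x - y), div_nonneg hm (by linarith : (0:ℝ) ≤ 1 + m)]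

/-! ## §5b For strongly convex `f` the proximal point CONTRACTS: `‖prox f x − prox f x′‖ ≤ (1+m)⁻¹‖x − x′‖` -/

/-- **STRONG FIRM NON-EXPANSIVENESS OF `prox`**: for `m`-strongly convex `f` (`0 ≤ m`),
`(1 + m)‖prox f x − prox f x′‖² ≤ ⟪x − x′, prox f x − prox f x′⟫` — add the strong subgradient inequalities at the two proximal points
(§5's `strongSubgradient_prox`, each tested at the other point). [folklore] -/
theorem inner_prox_sub_ge_of_strongConvexOn {m : ℝ} (hf : StrongConvexOn univ m f) (hm : 0 ≤ m) (x x' : E) :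
    (1 + m) * ‖prox f x - prox f x'‖ ^ 2 ≤ ⟪x - x', prox f x - prox f x'⟫ := by
  have h1 := strongSubgradient_prox hf hm x (prox f x')
  have h2 := strongSubgradient_prox hf hm x' (prox f x)
  have e1 : ‖prox f x' - prox f x‖ = ‖prox f x - prox f x'‖ := norm_sub_rev _ _
  have e2 : ⟪x - prox f x, prox f x' - prox f x⟫ + ⟪x' - prox f x', prox f x - prox f x'⟫
      = -⟪x - x', prox f x - prox f x'⟫ + ‖prox f x - prox f x'‖ ^ 2 := by
    have ea : prox f x' - prox f x = -(prox f x - prox f x') := by abel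
    have eb : x' - prox f x' = (x - prox f x) - ((x - x') - (prox f x - prox f x')) := by abel
    rw [ea, inner_neg_right, eb, inner_sub_left ((x - prox f x)) ((x - x') - (prox f x - prox f x')),
      inner_sub_left (x - x') (prox f x - prox f x'), real_inner_self_eq_norm_sq]
    ring
  rw [e1] at h1
  nlinarith [h1, h2, e2]

/-- **THE PROXIMAL POINT IS A `(1+m)⁻¹`-CONTRACTION** for `m`-strongly convex `f` (`0 ≤ m`): `‖prox f x − prox f x′‖ ≤ (1+m)⁻¹‖x − x′‖` — the
soft step's MINIMISER (the background field, in the road's reading) depends Lipschitz on the kept variable with the sharp constant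
(`f = (m∕2)‖·‖²`: `prox f x = (1+m)⁻¹x`); `m = 0` is the tree's `…ProximalMap.norm_prox_sub_prox_le`. [folklore] -/
theorem norm_prox_sub_le_of_strongConvexOn {m : ℝ} (hf : StrongConvexOn univ m f) (hm : 0 ≤ m) (x x' : E) :
    ‖prox f x - prox f x'‖ ≤ (1 + m)⁻¹ * ‖x - x'‖ := by
  have h1m : 0 < 1 + m := by linarith
  have h := inner_prox_sub_ge_of_strongConvexOn hf hm x x'
  have hcs : ⟪x - x', prox f x - prox f x'⟫ ≤ ‖x - x'‖ * ‖prox f x - prox f x'‖ := real_inner_le_norm _ _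
  rw [← div_eq_inv_mul, le_div_iff₀ h1m]
  nlinarith [norm_nonneg (x - x'), norm_nonneg (prox f x - prox f x')]

/-! ## §6 Toys: the hypotheses are inhabited and the constants are met -/

/-- `prox 0 = id`: the zero function's proximal point at `x` is `x` (`0 ∈ ∂0(x)`). [folklore] -/
theorem prox_zero (x : E) : prox (fun _ : E => (0 : ℝ)) x = x := by
  rw [prox_eq_iff (convexOn_const 0 convex_univ)]
  intro y _
  simp

/-- `e_0 = 0`: the envelope of the zero function vanishes (so the growth letter `e_0(x′) ≤ 0 + 0 + ½‖x′ − x‖²` holds with room and the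
lower letter with modulus `0` is an equality). [folklore] -/
theorem proxEnv_zero (x : E) : proxFun (fun _ : E => (0 : ℝ)) x (prox (fun _ : E => (0 : ℝ)) x) = 0 := by
  rw [prox_zero, proxFun_apply, sub_self, norm_zero]; norm_num

/-- `prox (½‖·‖²) x = ½ • x` (`x − ½x = ½x = ∇(½‖·‖²)(½x)`); here `m = 1` and `e_f = ¼‖·‖²` has modulus exactly `m∕(1+m) = ½`. [folklore] -/
theorem prox_half_norm_sq (x : E) : prox (fun z : E => ‖z‖ ^ 2 / 2) x = (1 / 2 : ℝ) • x := by
  have hc : ConvexOn ℝ univ (fun z : E => ‖z‖ ^ 2 / 2) := by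
    have h0 : StrongConvexOn univ (-1) (fun _ : E => (0 : ℝ)) :=
      (strongConvexOn_zero.mpr (convexOn_const (0 : ℝ) convex_univ)).mono (by norm_num)
    refine (strongConvexOn_iff_convex.mp h0).congr fun z _ => ?_
    simp only
    ring
  rw [prox_eq_iff hc]
  intro y _
  have e1 : x - (1 / 2 : ℝ) • x = (1 / 2 : ℝ) • x := by
    rw [show x - (1 / 2 : ℝ) • x = (1 : ℝ) • x - (1 / 2 : ℝ) • x by rw [one_smul], ← sub_smul]; norm_num
  simp only
  rw [e1, real_inner_smul_left, inner_sub_right x y ((1 / 2 : ℝ) • x), real_inner_smul_right, real_inner_self_eq_norm_sq,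
    norm_smul, Real.norm_eq_abs, abs_of_pos (by norm_num : (0 : ℝ) < 1 / 2)]
  have h := norm_sub_sq_real y ((1 / 2 : ℝ) • x)
  rw [real_inner_smul_right, norm_smul, Real.norm_eq_abs, abs_of_pos (by norm_num : (0 : ℝ) < 1 / 2), real_inner_comm] at h
  nlinarith [h, sq_nonneg ‖y - (1 / 2 : ℝ) • x‖, sq_nonneg ‖x‖]

end Summit.QuantumFields.BalabanUV.T4Continuum.NE7b.MoreauEnvelopeLetters
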